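import Summits.BirchSwinnertonDyer.BirchSwinnertonDyer.Theorems.AdditiveRankOneLowerHalfOfUnrFrame
import Summits.BirchSwinnertonDyer.BirchSwinnertonDyer.Theorems.AdditiveRankOneControlLeOfPoitouTate
import HarnessLib

/-!
# The r = 1 LOWER half at an additive prime from an `R₀`-frame and the `R₀`-Eisenstein inclusion, RE-KEYED to the control
# INEQUALITY: on the tower-surjective wild rank-one rows K9's 19200 LOWER half ⟸ 20928 ∧ 20479 ∧ A161″ ∧ PT1 ∧ print —
# `poitouTate_sha_tateDual`, Serre 1967 / Fin_v, local Euler–Poincaré, cd ≤ 2, Brink no longer hypotheses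

Cell `bsd-wall` (W-ALL row 2·3@3, lane 3), seat `bsd-wall-utd-p3` (prover, gen 6), 2026-08-28. Sequel of
`Theorems/AdditiveRankOneControlLeOfPoitouTate.lean` (this seat: the control INEQUALITY `AdditiveControlLeOnTreeAt … 0 P` + CTL₀
at every frame of every Heegner datum of an additive curve from `poitouTate_selmerStructure_duality` and Kolyvagin ALONE, any
reduction type) applied to bsd-potss-kmc g20's `R₀`-frame road (`Theorems/AdditiveRankOneLowerHalfOfUnrFrame.lean`), whose
§1 consumed the control EQUALITY only through the K1 STEP L link — i.e. only as `≤`.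

* §1 `indexLowerBoundLeAt_of_unrFrame_of_unrInclLe_of_controlLe` — kmc §1 with `hCtl` weakened to the `≤` half.
* §2 `missingLowerBoundAt_of_unrFrame_of_unrEisenstein_of_controlLe_of_twistUpper_row` — kmc §2 likewise (row-local, any odd
  additive `p`).
* §3 `missingLowerBoundAt_wildRankOne_towerSurj_of_frame20928_of_eisenstein20479_of_katoTam_of_poitouTate` — kmc §3 with the
  seven cohomological named facts replaced by ONE (`poitouTate_selmerStructure_duality`): the r = 1 LOWER half on the
  tower-surjective wild rows from the TEXTS of UTD 20928 and SOED 20479, Kato A161″, PT1, Liu–Zhang–Zhang, ToricPublishedInputs.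

HONEST FRAMING: CONDITIONAL on every displayed hypothesis (two registered crux texts, PT1, print binders); theorems only; closes
nothing; BSD₃ for no curve. The `≥` half of control — and with it every UPPER-half / exact-index statement — still needs
`poitouTate_sha_tateDual` (or Kolyvagin's printed bound on `3 ∤ c·∏c_ℓ` rows).

References: [Castella2018] Thm 3.1, §3; [JetchevSkinnerWan2017] §7.4.1, Thm. 3.3.1; [LiuZhangZhang2018] Thm 1.5.1/1.5.3;
[Kato2004Asterisque] Thm. 14.5 (3), Prop. 14.16 (2); [MilneADT2006] I Thm. 4.10(b); [GrossZagier1986] I.(6.3); [Kolyvagin1990] Thm. A.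
-/

noncomputable section

open scoped Classical

set_option linter.dupNamespace false
set_option autoImplicit false

namespace Summit.BirchSwinnertonDyer.BirchSwinnertonDyer.Theorems.AdditiveRankOneLowerHalfControlLe

open WeierstrassCurve NumberField IsDedekindDomain Field PowerSeries
  Literature.NumberTheory.EllipticCurves
  Literature.NumberTheory.EllipticCurves.ModularForms
  Literature.NumberTheory.EllipticCurves.Rank1Residual
  Literature.NumberTheory.EllipticCurves.Rank1Residual.Typed
  Literature.NumberTheory.EllipticCurves.KrizLi2019
  Literature.NumberTheory.GaloisRepresentations
  Literature.NumberTheory.GaloisCohomology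
  Summit.BirchSwinnertonDyer.Rank1Residual
  Summit.BirchSwinnertonDyer.Rank1Residual.Additive
  Summit.BirchSwinnertonDyer.Rank1Residual.X11b
  Summit.BirchSwinnertonDyer.Rank1Residual.X11b.AcSelmer
  Summit.BirchSwinnertonDyer.Rank1Residual.X11b.Halves
  Summit.BirchSwinnertonDyer.Rank1Residual.X11b.CongruenceLimit
  Summit.BirchSwinnertonDyer.BirchSwinnertonDyer.Theses.UniversalToricDescent
  Summit.BirchSwinnertonDyer.BirchSwinnertonDyer.Theorems.AdditivePotSupersingularControl
  Summit.BirchSwinnertonDyer.BirchSwinnertonDyer.Theorems.UniversalToricDescentWaldspurgerFlat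
  Summit.BirchSwinnertonDyer.BirchSwinnertonDyer.Theorems.SchneiderFreeControlAtoms
  Summit.BirchSwinnertonDyer.BirchSwinnertonDyer.Theorems.AdditiveRankOneControlLe

/-! ## §1 STEP L from an `R₀`-frame, the `R₀`-Eisenstein inclusion and the control INEQUALITY -/

section Datum

variable {p : ℕ} [Fact p.Prime] {W : WeierstrassCurve ℚ} [W.IsElliptic] [W.IsGloballyMinimal]
  {N : ℕ} [NeZero N] {K : Type} [Field K] [NumberField K]

/-- **STEP L at slack `v_p(c)` from an `R₀`-FRAME, the `R₀`-Eisenstein inclusion and the control INEQUALITY.** kmc g20's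
`indexLowerBoundLeAt_of_unrFrame_of_unrInclLe_of_control` VERBATIM with its control hypothesis WEAKENED from the pointwise
EQUALITY `SchneiderFree.AdditiveControlOnTreeAt` to the `≤` half `SchneiderFreeControlAtoms.AdditiveControlLeOnTreeAt … 0 P`
(whose CTL₀ conjunct still feeds the torsion guard of the inclusion): the proof consumed control only through the K1 link,
which needs `≤` (`AdditiveRankOneControlLe.indexLowerBoundLeAt_of_imcLowerLe_of_controlLe_zero`). At one Heegner datum
`(N, K, Dt, H, ι, P)` of `W` additive at the odd `p`: frame supply + inclusion + `≤`-control ⟹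
`IndexLowerBoundLeAt W p K P (v_p c)`. CONDITIONAL; closes nothing. [cite: Castella2018, Thm. 3.1 and §3 (arXiv:1704.06608 pp. 8–9)]
[cite: JetchevSkinnerWan2017, §7.4.1 (arXiv:1512.06894 p. 30)] [cite: LiuZhangZhang2018, Thm 1.5.1 and Thm 1.5.3 (Duke Math. J. 167 pp. 748–749)] -/
theorem indexLowerBoundLeAt_of_unrFrame_of_unrInclLe_of_controlLe (hp2 : p ≠ 2)
    (hL : LiuZhangZhang2018.thm151_thm153_modularCurve_heegnerVector_additive)
    (Dt : ModularParametrizationData W N) (H : HeegnerDatum N (NumberField.discr K)) (ι : K →+* ℂ)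
    (P : (W.baseChange K).toAffine.Point) (haddv : Addv W p) (hN : W.conductorNorm ℤ = N) (hK : IsImaginaryQuadratic K)
    (hHN : SatisfiesHeegnerHypothesis N K) (hd4 : NumberField.discr K < -4)
    (hP : WeierstrassCurve.Affine.Point.map ι.toRatAlgHom P = heegnerPointComplex Dt H) (hnt : ¬ IsOfFinAddOrder P)
    (hKo : Literature.NumberTheory.EllipticCurves.kolyvagin N W K)
    (hFr : ∀ (κ : ZpExtension K p), κ.IsAnticyclotomic → ∀ (γ : Field.absoluteGaloisGroup K) [Fact (κ.IsTopGenerator γ)]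
        (𝔭 : HeightOneSpectrum (𝓞 K)), ((p : ℕ) : 𝓞 K) ∈ 𝔭.asIdeal →
        ∃ ι' : PadicAlgCl p ≃+* ℂ, SchneiderFree.BranchInducesPrime p ι' 𝔭 ∧
          ∃ (ΩK : ℂ) (Ωp : ℂ_[p]) (L : UnrSeries p), ΩK ≠ 0 ∧ Ωp ≠ 0 ∧ IsBDPLFunction ι' 𝔭 κ γ Dt.f ΩK Ωp L)
    (hIncl : ∀ (κ : ZpExtension K p), κ.IsAnticyclotomic → ∀ (γ : Field.absoluteGaloisGroup K) [Fact (κ.IsTopGenerator γ)]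
        (𝔭 : HeightOneSpectrum (𝓞 K)), ((p : ℕ) : 𝓞 K) ∈ 𝔭.asIdeal → 𝔭.asIdeal.ramificationIdx (𝓞 ℚ) = 1 →
        𝔭.asIdeal.inertiaDeg (𝓞 ℚ) = 1 → ∀ (𝔭' : HeightOneSpectrum (𝓞 K)), ((p : ℕ) : 𝓞 K) ∈ 𝔭'.asIdeal → 𝔭' ≠ 𝔭 →
        ∀ (ι' : PadicAlgCl p ≃+* ℂ), SchneiderFree.BranchInducesPrime p ι' 𝔭 →
        ∀ (ΩK : ℂ) (Ωp : ℂ_[p]) (L : UnrSeries p), ΩK ≠ 0 → Ωp ≠ 0 → IsBDPLFunction ι' 𝔭 κ γ Dt.f ΩK Ωp L →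
          Module.IsTorsion (IwasawaAlgebra p) (XAc (W.baseChange K) p κ 𝔭' ∅ γ) →
          (XAc.charIdeal (W.baseChange K) p κ 𝔭' ∅ γ).map (PowerSeries.map (toUnr p)) ≤ Ideal.span {L})
    (hCtl : ∀ (κ : ZpExtension K p), κ.IsAnticyclotomic → ∀ (γ : Field.absoluteGaloisGroup K) [Fact (κ.IsTopGenerator γ)]
        (𝔭 : HeightOneSpectrum (𝓞 K)) (h𝔭 : ((p : ℕ) : 𝓞 K) ∈ 𝔭.asIdeal) (he : 𝔭.asIdeal.ramificationIdx (𝓞 ℚ) = 1)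
        (hf : 𝔭.asIdeal.inertiaDeg (𝓞 ℚ) = 1), AdditiveControlLeOnTreeAt p κ 𝔭 γ (embAt K p 𝔭 h𝔭 he hf) 0 P) :
    SchneiderFree.IndexLowerBoundLeAt W p K P (padicValNat p Dt.c.natAbs) := by
  have hp : p.Prime := Fact.out
  have hpN : p ∣ W.conductorNorm ℤ :=
    (W.dvd_conductorNorm_iff_not_hasGoodReductionAtPrime p).mpr (not_good_of_addv W p haddv)
  have hsplit : SplitsIn K p := by rw [hN] at hpN; exact hHN p hp hpN
  have hp2N : p ^ 2 ∣ N := by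
    rw [← hN]
    by_contra h
    rcases hasGoodReductionAtPrime_or_hasMultiplicativeReductionAtPrime_of_not_sq_dvd_conductorNorm (V := W) h
      with hg | hm
    · exact haddv.1 hg
    · exact haddv.2 hm
  obtain ⟨hrk, hfin⟩ := hKo hK hHN ⟨Dt, H, ι, hP⟩ hnt
  -- a frame `(κ, γ, 𝔭, 𝔭′ ≠ 𝔭)` and an `R₀`-frame there (hypothesis), read in `𝓞_{ℂ_p}⟦T⟧`
  obtain ⟨κ, γ, -, hκ, hγ, -⟩ := X11b.exists_anticyclotomic_generator_prime (p := p) hK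
  haveI : Fact (κ.IsTopGenerator γ) := ⟨hγ⟩
  obtain ⟨𝔭, h𝔭, he, hf⟩ := X11b.exists_degreeOnePrime_of_splitsIn K p hK.1 hsplit
  obtain ⟨𝔭', hne, h𝔭', he', hf'⟩ := X11b.Three.exists_ne_degreeOne_prime hK.1 h𝔭 he hf
  obtain ⟨ι', hind, ΩK, Ωp, L, hΩK, hΩp, hBDP⟩ := hFr κ hκ γ 𝔭 h𝔭
  set Q : PowerSeries (PadicComplexInt p) := PowerSeries.map (R1.unrToCpInt p) L with hQdef
  have hBDPQ : R1.IsBDPLFunctionInt p ι' 𝔭 κ γ Dt.f ΩK Ωp Q := R1.isBDPLFunctionInt_map hBDP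
  obtain ⟨u, hu, hval⟩ := intSeries_value_of_frame_manin hL W K 𝔭 κ γ Dt H ι P Dt.f Dt.isNewformOf hp2 hN hp2N hK hd4 h𝔭
    he hf hHN hκ hP hnt ι' hind hΩK hΩp hBDPQ
  -- the control INEQUALITY at `𝔭′`; its CTL₀ conjunct feeds the torsion guard of the `R₀`-inclusion
  obtain ⟨n, hn, hnle⟩ := hCtl κ hκ γ 𝔭' h𝔭' he' hf'
  have hle : (XAc.charIdeal (W.baseChange K) p κ 𝔭' ∅ γ).map (PowerSeries.map (R1.toCpInt p)) ≤ Ideal.span {Q} :=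
    ideal_map_toCpInt_le_span_of_map_toUnr_le _ L (hIncl κ hκ γ 𝔭 h𝔭 he hf 𝔭' h𝔭' hne ι' hind ΩK Ωp L hΩK hΩp hBDP hn.1)
  have hc0 : Dt.c ≠ 0 := Dt.maninConstant_ne_zero_holds
  have hc0' : (Dt.c : ℚ_[p]) ≠ 0 := by exact_mod_cast hc0
  have hlog : logOmega W p (embAt K p 𝔭' h𝔭' he' hf') P ≠ 0 := X11b.R1.logOmega_ne_zero W p _ hnt
  have hsq : (algebraMap ℚ_[p] ℂ_[p] (logOmega W p (embAt K p 𝔭 h𝔭 he hf) P / (Dt.c : ℚ_[p]))) ^ 2 =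
      (algebraMap ℚ_[p] ℂ_[p] (logOmega W p (embAt K p 𝔭' h𝔭' he' hf') P / (Dt.c : ℚ_[p]))) ^ 2 := by
    rw [← map_pow, ← map_pow, div_pow, div_pow,
      SchneiderFreeAdditiveX3.sq_logOmega_embAt_eq_of_rank_one W p hK.1 hrk h𝔭 he hf h𝔭' he' hf' P]
  have hval' : IntSeries.HasValueAt Q 0
      (u * (algebraMap ℚ_[p] ℂ_[p] (logOmega W p (embAt K p 𝔭' h𝔭' he' hf') P / (Dt.c : ℚ_[p]))) ^ 2) := by
    rw [← hsq]; exact hval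
  have hlow : SchneiderFree.AdditiveIMCLowerBDPOnTreeLeAt p κ 𝔭' γ (embAt K p 𝔭' h𝔭' he' hf')
      (padicValNat p Dt.c.natAbs) P := by
    obtain ⟨htors, f, hfI, hf0, hfn⟩ := hn
    have hmem : PowerSeries.map (R1.toCpInt p) f ∈ Ideal.span {Q} := by
      have h3 := hle
      rw [hfI, map_span_singleton_powerSeries] at h3
      exact (Ideal.span_singleton_le_iff_mem _).mp h3
    obtain ⟨-, hle'⟩ := int_two_mul_valuation_le_of_map_mem_span hf0 hmem hu hval'
    rw [div_eq_mul_inv, Padic.valuation_mul hlog (inv_ne_zero hc0'), Padic.valuation_inv,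
      Padic.valuation_intCast, valuation_logOmega hlog, hfn] at hle'
    refine ⟨n, ⟨htors, f, hfI, hf0, hfn⟩, ?_⟩
    simp only [padicValInt] at hle'
    linarith
  exact indexLowerBoundLeAt_of_imcLowerLe_of_controlLe_zero hN hK hHN hfin hlow ⟨n, hn, hnle⟩

end Datum

/-! ## §2 The row-local r = 1 LOWER half, control as `≤` -/

/-- **The row-local r = 1 LOWER half `MissingLowerBoundAt W p` at ANY odd additive prime from an `R₀`-frame supply, the
`R₀`-Eisenstein inclusion (torsion-guarded), the control INEQUALITY and the twists' r = 0 UPPER half** — kmc g20's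
`missingLowerBoundAt_of_unrFrame_of_unrEisenstein_of_control_of_twistUpper_row` with control weakened to `≤`.
`= missingLowerBoundAt_of_indexLower_of_twistUpperOdd_row ∘ §1`. CONDITIONAL; closes nothing.
[cite: JetchevSkinnerWan2017, §7.4.1 (arXiv:1512.06894 p. 30)] [cite: Castella2018, Thm. 3.1 and §3 (arXiv:1704.06608 pp. 8–9)]
[cite: GrossZagier1986, I.(6.3)] -/
theorem missingLowerBoundAt_of_unrFrame_of_unrEisenstein_of_controlLe_of_twistUpper_row (p : ℕ) [Fact p.Prime] (hp2 : p ≠ 2)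
    (hL : LiuZhangZhang2018.thm151_thm153_modularCurve_heegnerVector_additive) (hF : ToricPublishedInputs)
    (W : WeierstrassCurve ℚ) [W.IsElliptic] [W.IsGloballyMinimal] (haddv : Addv W p) (hr : W.analyticRank = 1)
    (hFr : ∀ (N : ℕ) [NeZero N] (K : Type) [Field K] [NumberField K] (Dt : ModularParametrizationData W N),
      W.conductorNorm ℤ = N → IsImaginaryQuadratic K → SatisfiesHeegnerHypothesis N K →
      ∀ (κ : ZpExtension K p), κ.IsAnticyclotomic → ∀ (γ : Field.absoluteGaloisGroup K) [Fact (κ.IsTopGenerator γ)]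
        (𝔭 : HeightOneSpectrum (𝓞 K)), ((p : ℕ) : 𝓞 K) ∈ 𝔭.asIdeal →
        ∃ ι' : PadicAlgCl p ≃+* ℂ, SchneiderFree.BranchInducesPrime p ι' 𝔭 ∧
          ∃ (ΩK : ℂ) (Ωp : ℂ_[p]) (L : UnrSeries p), ΩK ≠ 0 ∧ Ωp ≠ 0 ∧ IsBDPLFunction ι' 𝔭 κ γ Dt.f ΩK Ωp L)
    (hIncl : ∀ (N : ℕ) [NeZero N] (K : Type) [Field K] [NumberField K] (Dt : ModularParametrizationData W N),
      W.conductorNorm ℤ = N → IsImaginaryQuadratic K → SatisfiesHeegnerHypothesis N K →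
      ∀ (κ : ZpExtension K p), κ.IsAnticyclotomic → ∀ (γ : Field.absoluteGaloisGroup K) [Fact (κ.IsTopGenerator γ)]
        (𝔭 : HeightOneSpectrum (𝓞 K)), ((p : ℕ) : 𝓞 K) ∈ 𝔭.asIdeal → 𝔭.asIdeal.ramificationIdx (𝓞 ℚ) = 1 →
        𝔭.asIdeal.inertiaDeg (𝓞 ℚ) = 1 → ∀ (𝔭' : HeightOneSpectrum (𝓞 K)), ((p : ℕ) : 𝓞 K) ∈ 𝔭'.asIdeal → 𝔭' ≠ 𝔭 →
        ∀ (ι' : PadicAlgCl p ≃+* ℂ), SchneiderFree.BranchInducesPrime p ι' 𝔭 →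
        ∀ (ΩK : ℂ) (Ωp : ℂ_[p]) (L : UnrSeries p), ΩK ≠ 0 → Ωp ≠ 0 → IsBDPLFunction ι' 𝔭 κ γ Dt.f ΩK Ωp L →
          Module.IsTorsion (IwasawaAlgebra p) (XAc (W.baseChange K) p κ 𝔭' ∅ γ) →
          (XAc.charIdeal (W.baseChange K) p κ 𝔭' ∅ γ).map (PowerSeries.map (toUnr p)) ≤ Ideal.span {L})
    (hCtl : ∀ (N : ℕ) [NeZero N] (K : Type) [Field K] [NumberField K] (Dt : ModularParametrizationData W N)
      (H : HeegnerDatum N (NumberField.discr K)) (ι : K →+* ℂ) (P : (W.baseChange K).toAffine.Point),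
      W.conductorNorm ℤ = N → IsImaginaryQuadratic K → SatisfiesHeegnerHypothesis N K →
      (W.quadraticTwist (NumberField.discr K : ℚ)).entireLFunction 1 ≠ 0 →
      WeierstrassCurve.Affine.Point.map ι.toRatAlgHom P = heegnerPointComplex Dt H → ¬ IsOfFinAddOrder P →
      Literature.NumberTheory.EllipticCurves.kolyvagin N W K →
      ∀ (κ : ZpExtension K p), κ.IsAnticyclotomic → ∀ (γ : Field.absoluteGaloisGroup K) [Fact (κ.IsTopGenerator γ)]
        (𝔭 : HeightOneSpectrum (𝓞 K)) (h𝔭 : ((p : ℕ) : 𝓞 K) ∈ 𝔭.asIdeal) (he : 𝔭.asIdeal.ramificationIdx (𝓞 ℚ) = 1)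
        (hf : 𝔭.asIdeal.inertiaDeg (𝓞 ℚ) = 1),
        AdditiveControlLeOnTreeAt p κ 𝔭 γ (embAt K p 𝔭 h𝔭 he hf) 0 P)
    (hTwUp : ∀ (N : ℕ) [NeZero N] (K : Type) [Field K] [NumberField K]
      (Wd : WeierstrassCurve ℚ) [Wd.IsElliptic] [Wd.IsGloballyMinimal],
      W.conductorNorm ℤ = N → IsImaginaryQuadratic K → SatisfiesHeegnerHypothesis N K → Odd (NumberField.discr K) →
      NumberField.discr K < -4 → (∃ C : VariableChange ℚ, C • W.quadraticTwist (NumberField.discr K : ℚ) = Wd) →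
      (W.quadraticTwist (NumberField.discr K : ℚ)).entireLFunction 1 ≠ 0 → MissingUpperBoundAt Wd p) :
    MissingLowerBoundAt W p := by
  have hKo : ∀ (N : ℕ) [NeZero N] (W : WeierstrassCurve ℚ) (K : Type) [Field K] [NumberField K],
      Literature.NumberTheory.EllipticCurves.kolyvagin N W K := hF.2.1
  refine missingLowerBoundAt_of_indexLower_of_twistUpperOdd_row p hp2 hF W haddv hr ?_ hTwUp
  intro N _ K _ _ Dt H ι P hN hK hHN _hodd hd4 hLt hP hnt
  exact indexLowerBoundLeAt_of_unrFrame_of_unrInclLe_of_controlLe hp2 hL Dt H ι P haddv hN hK hHN hd4 hP hnt (hKo N W K)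
    (fun κ hκ γ _ 𝔭 h𝔭 ↦ hFr N K Dt hN hK hHN κ hκ γ 𝔭 h𝔭)
    (fun κ hκ γ _ 𝔭 h𝔭 he hf 𝔭' h𝔭' hne ι' hind ΩK Ωp L hΩK hΩp hBDP htors ↦
      hIncl N K Dt hN hK hHN κ hκ γ 𝔭 h𝔭 he hf 𝔭' h𝔭' hne ι' hind ΩK Ωp L hΩK hΩp hBDP htors)
    (fun κ hκ γ _ 𝔭 h𝔭 he hf ↦ hCtl N K Dt H ι P hN hK hHN hLt hP hnt (hKo N W K) κ hκ γ 𝔭 h𝔭 he hf)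

/-! ## §3 K9's 19200 LOWER half on the tower-surjective wild rows from the TEXTS of UTD 20928 and SOED 20479 — ONE named fact -/

/-- **The LOWER half of K9's residual `WildRankOne` (stmt-BirchSwinnertonDyer-19200) on the `3`-adic TOWER-SURJECTIVE rows from
the registered texts of UTD's child `WildSplitFrameAtThree` (20928) and SOED's Eisenstein inclusion (20479 / E′ 24155 in
`R₀`-currency) — kmc g20's `…_of_katoTam_of_facts` with its SEVEN cohomological named facts CUT TO ONE**: control enters the
lower half only as `≤`, which `AdditiveRankOneControlLe.additiveControlLeOnTreeAt_of_poitouTate_of_heegner` supplies from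
`poitouTate_selmerStructure_duality` alone (Kolyvagin being the antecedent `kolyvagin N W K` of the datum); so
`poitouTate_sha_tateDual`, `localEulerPoincareCharacteristic`, `fieldCdLE_two_of_numberField`, Brink Thm 2 / Cor 1 and Serre
1967 §5 Prop. 8 are NOT hypotheses here. Conclusion unchanged: `∀ W, r_an = 1 → ClassO6 W 3 → TowerSurjThree W →
MissingLowerBoundAt W 3` ⟸ [20928 text] ∧ [20479 text] ∧ A161″ ∧ PT1 ∧ LZZ ∧ ToricPublishedInputs. CONDITIONAL; closes nothing.
[cite: JetchevSkinnerWan2017, §7.4.1 and Thm. 3.3.1 (arXiv:1512.06894)] [cite: Castella2018, Thm. 3.1 and §3 (arXiv:1704.06608 pp. 8–9)]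
[cite: Kato2004Asterisque, Thm. 14.5 (3), Prop. 14.16 (2)] [cite: LiuZhangZhang2018, Thm 1.5.1 and Thm 1.5.3 (Duke Math. J. 167 pp. 748–749)]
[cite: MilneADT2006, Ch. I, Thm. 4.10(b)] [cite: GrossZagier1986, I.(6.3)] -/
theorem missingLowerBoundAt_wildRankOne_towerSurj_of_frame20928_of_eisenstein20479_of_katoTam_of_poitouTate
    [Fact (3 : ℕ).Prime]
    (hL : LiuZhangZhang2018.thm151_thm153_modularCurve_heegnerVector_additive)
    (hF : ToricPublishedInputs)
    (hKatoT : Kato2004.rankZero_padicValNat_sha_add_padicValNat_tamagawa_le_of_additive_potGood_of_imageContainsSL2)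
    (hPT : ∀ (K : Type) [Field K] [NumberField K], poitouTate_selmerStructure_duality K)
    (hFr : ∀ (W : WeierstrassCurve ℚ) [W.IsElliptic] [W.IsGloballyMinimal] (N : ℕ) [NeZero N] (K : Type) [Field K]
      [NumberField K] (Dt : ModularParametrizationData W N), ClassO6 W 3 → W.conductorNorm ℤ = N → IsImaginaryQuadratic K →
      SatisfiesHeegnerHypothesis N K → ∀ (κ : ZpExtension K 3), κ.IsAnticyclotomic →
      ∀ (γ : Field.absoluteGaloisGroup K) [Fact (κ.IsTopGenerator γ)] (𝔭 : HeightOneSpectrum (𝓞 K)),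
        ((3 : ℕ) : 𝓞 K) ∈ 𝔭.asIdeal → ∃ ι' : PadicAlgCl 3 ≃+* ℂ, SchneiderFree.BranchInducesPrime 3 ι' 𝔭 ∧
          ∃ (ΩK : ℂ) (Ωp : ℂ_[3]) (L : UnrSeries 3), ΩK ≠ 0 ∧ Ωp ≠ 0 ∧ IsBDPLFunction ι' 𝔭 κ γ Dt.f ΩK Ωp L)
    (hX : ∀ (W : WeierstrassCurve ℚ) [W.IsElliptic] [W.IsGloballyMinimal] (N : ℕ) [NeZero N] (K : Type) [Field K]
      [NumberField K] (Dt : ModularParametrizationData W N), ClassO6 W 3 → W.HasSurjectiveModNGaloisRep 3 →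
      W.analyticRank = 1 → W.conductorNorm ℤ = N → IsImaginaryQuadratic K → SatisfiesHeegnerHypothesis N K →
      ∀ (κ : ZpExtension K 3), κ.IsAnticyclotomic → ∀ (γ : Field.absoluteGaloisGroup K) [Fact (κ.IsTopGenerator γ)]
        (𝔭 : HeightOneSpectrum (𝓞 K)), ((3 : ℕ) : 𝓞 K) ∈ 𝔭.asIdeal → 𝔭.asIdeal.ramificationIdx (𝓞 ℚ) = 1 →
        𝔭.asIdeal.inertiaDeg (𝓞 ℚ) = 1 → ∀ (𝔭' : HeightOneSpectrum (𝓞 K)), ((3 : ℕ) : 𝓞 K) ∈ 𝔭'.asIdeal → 𝔭' ≠ 𝔭 →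
        ∀ (ι' : PadicAlgCl 3 ≃+* ℂ), SchneiderFree.BranchInducesPrime 3 ι' 𝔭 →
        ∀ (ΩK : ℂ) (Ωp : ℂ_[3]) (L : UnrSeries 3), ΩK ≠ 0 → Ωp ≠ 0 → IsBDPLFunction ι' 𝔭 κ γ Dt.f ΩK Ωp L →
          Module.IsTorsion (IwasawaAlgebra 3) (XAc (W.baseChange K) 3 κ 𝔭' ∅ γ) →
          (XAc.charIdeal (W.baseChange K) 3 κ 𝔭' ∅ γ).map (PowerSeries.map (toUnr 3)) ≤ Ideal.span {L}) :
    ∀ (W : WeierstrassCurve ℚ) [W.IsElliptic] [W.IsGloballyMinimal], W.analyticRank = 1 → ClassO6 W 3 →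
      AdditiveThree.TowerSurjThree W → MissingLowerBoundAt W 3 := by
  intro W _ _ hr hO6 hT
  have hsurj := forall_hasSurjectiveModNGaloisRep_pow_three_of_towerSurjThree W hT
  have h1 : W.HasSurjectiveModNGaloisRep 3 := by
    have h := hsurj 1
    simp only [pow_one] at h
    exact_mod_cast h
  have haddv : Addv W 3 := hO6.2.1
  have hj : 0 ≤ padicValRat 3 W.j := hO6.padicValRat_j_nonneg
  have hGZK : rank_eq_analyticRank_of_analyticRank_le_one := hF.2.2.1
  have hmod : hasEntireLFunction_rat := hF.2.2.2.1
  exact missingLowerBoundAt_of_unrFrame_of_unrEisenstein_of_controlLe_of_twistUpper_row 3 (by decide) hL hF W haddv hr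
    (fun N _ K _ _ Dt hN hK hHN κ hκ γ _ 𝔭 h𝔭 ↦ hFr W N K Dt hO6 hN hK hHN κ hκ γ 𝔭 h𝔭)
    (fun N _ K _ _ Dt hN hK hHN κ hκ γ _ 𝔭 h𝔭 he hf 𝔭' h𝔭' hne ι' hind ΩK Ωp L hΩK hΩp hBDP htors ↦
      hX W N K Dt hO6 h1 hr hN hK hHN κ hκ γ 𝔭 h𝔭 he hf 𝔭' h𝔭' hne ι' hind ΩK Ωp L hΩK hΩp hBDP htors)
    (fun N _ K _ _ Dt H ι P hN hK hHN _hLt hP hnt hKo κ hκ γ _ 𝔭 h𝔭 he hf ↦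
      additiveControlLeOnTreeAt_of_poitouTate_of_heegner W 3 (by decide) haddv N K (hPT K) Dt H ι P hN hK hHN hP hnt
        hKo κ hκ γ 𝔭 h𝔭 he hf)
    (fun N _ K _ _ Wd _ _ hN hK hHN _hodd _hd4 hC hLt ↦
      missingUpperBoundAt_twist_of_towerSurj_of_katoTam 3 (by decide) hKatoT hGZK hmod W haddv hj hsurj hN K hK hHN Wd hC hLt)

end Summit.BirchSwinnertonDyer.BirchSwinnertonDyer.Theorems.AdditiveRankOneLowerHalfControlLe

end
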